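import Literature.MathematicalPhysics.QuantumFieldTheory.Balaban1983to89.Node00.HistoryTermDatum214WindowDilated

/-!
# NODE 00 (YM-PLAN Track A) — W1 = [II] §2 (2.13)–(2.14), STOREY 12: THE LOCAL GROWTH SCHEMA OF THE UNSCALED-FIELD LAW's POTENTIALS AT A (2.14)
# TERM DATUM AS ONE RECORD (`W1.TermDatum214.LocalGrowthInputs`, its shadow `W1.TermDatum214.LocalGrowthLetters : Prop`) AND THE LAWS OF THE
# UNSCALED BOXES (`W1.TermDatum214.UnscaledBoxLaws : Prop`)

NODE 00 DEFINER MODULE (seat `pub-ymgap-node00-def-W1`, generation 14, 2026-08-27).  APPEND-ONLY: a NEW importing module; g13's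
`Node00/HistoryTermDatum214WindowDilated` (`UnscaledChi ∕ UnscaledWilson ∕ UnscaledOlder`, `UnscaledFieldLawOn`, `memberTF`) untouched and CONSUMED BY
NAME.  Typed on the pub-ymgap bus asks of seat `pub-ymgap-dag-n10-c` g7 (2026-08-27 13:26Z «d13‴: W1's growth schema should carry `S : D → Finset Λ`
bond supports, D-indexed (ℓ1)∕(L0)–(L6) letters, τ-radii R(Y), and either `hm₃` or its shell ingredients — §4's binder list is the target shape»;
13:31Z «d13‴ shape = §5's last-line binders»; 13:40Z «once W1∕N09 name 𝒲₃, D𝒪, S, R, c(·), m₃») and of the cell's transfer lens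
`ym-lens-BalabanUVNodes-transfer` g18 (13:14Z junction note: ONE bond-support map next to the law; 13:47Z demand d14 ∕ card T30 «m₃ IS (1.26)»: carry
the CUBE-LOCATION of the supports and the (2.19) PROFILE of the rate weight — NOT `m₃` as a primitive field, NOT shell counts — and DERIVE the per-bond
multiplicity by (1.26) on the torus), for the consumer announced by seat `pub-ymgap-dag-n22-c` g7 (13:05Z «W1-12 = the located-inputs RECORD of
J6∕J7∕J8's binders»): the fields and faces below are, BYTE FOR BYTE at the datum's pins, the LAST-LINE binders of dag-n10-c's
`B13Bound226CentredUnscaled.h226_torus_windowDilated_centred_of_localGrowth_perBond[_member]` (module 46 v1.1∕v1.2 §4∕§5; kernel-checked desk-side by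
one `exact` at the datum) — `hm₃0`, `hm₃` as DERIVED faces, every other binder as a field.
[II] = [Balaban1988RG2Cluster] T. Bałaban, *Renormalization group approach to lattice gauge field theories. II. Cluster expansions*, Commun. Math.
Phys. **116** (1988) 1–22; [I] = [Balaban1987RG1], part I, Commun. Math. Phys. **109** (1987) 249–301.

CITATION HEADER (PDF held: `paper:balaban1987-cmp109-rg-i-small-field`, journal page = PDF page + 248; `paper:balaban1988-cmp116-rg-ii-cluster`,
journal page = PDF page).  [II] p. 9 (1.34): Lemma 2's potentials are *"defined and analytic on … × {B : |B| < ε₁g_k⁻¹ on Y}"* — in the UNSCALED field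
`A = g_kB` the sup-ball `‖A‖ ≤ ε₁`, COUPLING-FREE — with (1.36) *"|𝐕″_k(Y,U,J,B)| ≤ |B|₀ε₁C₁M… exp C₂κ₁ exp(−(1−2δ)κ d_k(Y))"* (growth constants
DEPENDING ON THE DOMAIN through the decay in `d_k(Y)`); p. 11 Lemma 2 (1.41)–(1.43): `P^{(k)} + {…} = Σ_{Y∈𝐃_k} 𝐕_k(Y, U_{k+1}, B)`, each `𝐕_k(Y,·)`
*"a sum of two terms"* (1.42), a quadratic form with matrix elements bounded by (1.43) and `𝐕″` satisfying (1.36); p. 12 (2.2)–(2.3): the domain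
`Y₀ = ⋃_{Y∈𝐃} Y`, its bond set, and the decomposition `χ_k = χ_{k,Y₀} χ_{k,Y₀ᶜ} = Σ_P (−1)^{|P|} χ_{k,Y₀} χᶜ_{k,P}`; p. 16 between (2.19) and (2.20):
*"The sum of these quadratic forms over Y∈𝐃 is bounded by a quadratic form with the above matrix elements resummed over all Y∈𝐃_k containing, for
example, the point b₋. We use the first exponential factor in (2.19) to bound the sum, and this yields a constant O(1). In fact the constant is small
for κ₁ large, hence we can bound it by 1"* — THE PER-BOND RESUMMATION; p. 8 (1.26): *"Σ_{X∈𝐃_j, X⊃□′} exp(−κd_j(X)) ≤ O(1) (1.26) for κ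
sufficiently large"* — LANDED on the torus with explicit threshold and constant (`TreeLengthTorus.ineq126_torus`: κ ≥ κ₀(4·2^d, 2d) ⇒ ≤ K₀(4·2^d, 2d));
[I] p. 266 (2.8)–(2.9): *"Denoting terms of at least third order in H₁B′ by
V(H₁B′)"* and *"χ_k = Π χ({|B′(b)| < ε₁})"* — the Wilson remainder starts at THIRD order and the boxes constrain the UNSCALED field coordinatewise;
p. 267: *"Next we make the scaling transformation B = g_kB′ … the only term with a negative power of g_k is the action evaluated at U_{k+1}"*.

THE PIN.  W1-11 typed the unscaled-field LAW of the datum: at every real window coupling `s`, `χ_{k,Y₀}(s,B) = χᵘ(s·B)`, `χᶜ_{k,P}(s,B) = χᶜᵘ(s·B)`,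
`𝐕_k(Y; s, old, φ; B) = s⁻²𝒲(φ; Y, s·B) + 𝒪(old, φ; Y, s·B)` with COUPLING-FREE `χᵘ, χᶜᵘ, 𝒲, 𝒪`.  What print KNOWS about these coupling-free
functions — and what dag-n10-c's centred letter from LOCAL growth letters consumes as its last-line hypotheses — is likewise COUPLING-FREE, hence
uniform along the window (the point of the law): Lemma 2's analyticity∕growth on the sup-ball of the unscaled field with per-domain constants, the
cubic∕linear leading parts, the localisation of `𝒲(Y,·)` on the bonds of `Y` (the per-bond resummation of (2.20)), the box-support law of `χᵘ` and
the `Y`-locality of the potentials.  THIS STOREY TYPES THEM ONCE, W1-side, as ONE record per term slice: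
* §1 **`𝔇.LocalGrowthInputs χᵘ 𝒲 𝒪 Z t old φ Uτ`** (Type-valued record; a LIST OF HYPOTHESES on the opaque `χᵘ, 𝒲, 𝒪` — nothing asserted): data
  = the cubic part `𝒲₃(Y,·)` of `𝒲(φ; Y, ·)` and the linear part `D𝒪(Y,·)` of `𝒪(old, φ; Y, ·)` at `0`, the sup-ball radius `ρ` (print's `ε₁`), the
  per-domain τ-radii bounds `R(Y)` of the given τ-regions `Uτ` and growth constants `c₀ c₃ c₃′ c₄ c₁ c₁′ c₂ : 𝐃om → ℝ`, the BOND SUPPORTS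
  `S : 𝐃om → Finset Λ` (ONE map, shared by the localised cubic letter and the per-bond multiplicity), the CUBE-LOCATION `cubeOf : Λ → π_k` of the
  row bonds, the (2.19) PROFILE constants `C_p ≥ 0`, `κ_p ≥ κ₀(4·2^d, 2d)` of the rate weight, the box-support coordinate set `S₀`; propositions =
  measurability of `𝒲(φ;Y,·), 𝒪(old,φ;Y,·), 𝒲₃(Y,·), D𝒪(Y,·)`, the homogeneities `𝒲₃(Y, rA) = r³𝒲₃(Y, A)`, `D𝒪(Y, rA) = r·D𝒪(Y, A)`,
  nonnegativity of `R` and of the constants on `Y ∈ 𝐃`, `‖z‖ ≤ R(Y)` on `Uτ Y`, the LOCAL letters on `‖A‖ ≤ ρ` — (L0) `‖𝒪(Y,0)‖ ≤ c₀(Y)`, (L1)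
  `‖𝒲(Y,A)‖ ≤ c₃(Y)‖A‖³`, (ℓ1) `‖𝒲(Y,A)‖ ≤ c₃(Y)‖A‖Σ_{b∈S Y}A_b²`, (L2) `‖𝒲 − 𝒲₃‖ ≤ c₄(Y)‖A‖⁴`, (L4) `‖𝒪(Y,A) − 𝒪(Y,0)‖ ≤ c₁(Y)‖A‖`, (L5)
  `‖𝒪 − 𝒪(Y,0) − D𝒪‖ ≤ c₂(Y)‖A‖²` — the global (L3) `‖𝒲₃‖ ≤ c₃′(Y)‖A‖³`, (L6) `‖D𝒪‖ ≤ c₁′(Y)‖A‖`, (G) the supports lie in their domain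
  `b ∈ S Y → cubeOf b ∈ Y`, (P) the profile `R(Y)c₃(Y) ≤ C_p e^{−κ_p d_k(Y)}` (`d_k` = the torus tree length of [II] (1.26)∕(1.36)), the s-FREE
  BOX-SUPPORT LAW `χᵘ(A) ≠ 0 → ∀ b ∈ S₀, |A_b| ≤ ρ` and the `Y`-LOCALITY of `𝒲(φ;Y,·), 𝒪(old,φ;Y,·)` in `S₀`.  DERIVED faces: the per-bond
  multiplicity constant `m₃ := C_p·K₀(4·2^d, 2d)`, `hm₃0 : 0 ≤ m₃` and **`hm₃ : ∀ b, Σ_{Y∈𝐃, b∈S Y} R(Y)c₃(Y) ≤ m₃`** — print's «constant O(1)»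
  of p. 16 — by (1.26) ON THE TORUS (`TreeLengthTorus.ineq126_torus`, a tree theorem), so that dag-n10-c's binders `… S h1loc hm₃0 hm₃ …` are served
  by name (`I.S I.h1loc I.hm₃0 I.hm₃`).  The field ORDER is dag-n10-c's binder order.  KEPT OUTSIDE the record, by design: the real base point `s > 0`
  (the record is coupling-free), the free rate `δ > 0` and the two NUMERIC CLOSURE inequalities between the record's constants and the capstone's
  shared rates `a_c, w_c` (`2δ + 2ρ·m₃ ≤ a_c` ∕ `2δ + 8ρ·m₃ ≤ a_c` and the centred constants' letter `… ≤ e^{w_c}` — they DIFFER between the `b = 1`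
  edition §4 and the `b`-member edition §5 and sit with the consumer's capstone numerics), and the kernel∕box∕(2.22) blocks of the same theorems
  (W1-8's `Inputs226Holo` currency, displayed Summit-side per member).  Faces: `hbox_smul` (the law's box binder AT a base point `s₀`:
  `χᵘ(s₀·B) ≠ 0 → |(s₀·B)_b| ≤ ρ`, definitional), `restrict` (antitone in the τ-regions), the shadow `𝔇.LocalGrowthLetters … : Prop := Nonempty …`.
* §2 **`𝔇.UnscaledBoxLaws χᵘ χᶜᵘ Z t : Prop`** — the laws of [I] (2.9)'s boxes read in the unscaled field: `χᵘ, χᶜᵘ ≥ 0`, EVEN, measurable; faces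
  AT a base point (`nonneg_smul`, `even_smul`, `measurable_smul`: the Summit-side binders `hχ0 hχc0 hχe hχce hχm hχcm` at `s₀·B`).
* §3 HONESTY — THE SCHEMA IS CONSISTENT: the zero potentials with empty supports and the zero profile inhabit `LocalGrowthInputs` as soon as the
  τ-regions are bounded on `𝐃` (`localGrowthInputsZero`, `localGrowthLetters_zero`); the constant boxes inhabit `UnscaledBoxLaws` (`unscaledBoxLaws_const`).
All proofs are projections ∕ `rfl` ∕ `simp` bookkeeping plus ONE application of the tree's (1.26) (`hm₃`); NO estimate of Bałaban's is proved or asserted.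

WHAT IS LEFT TO THE CONSUMERS (not typed here — one declarer each): the member statements at the datum from these records (Summit-side J-files of
seat `pub-ymgap-dag-n22-c`: ONE application of dag-n10-c's §4∕§5 with the last-line binders read off the record field by field, plus `s > 0`, `δ`,
the two closure inequalities and the kernel∕box∕(2.22) blocks); the inhabitant OF RECORD (NODE 00's datum read from def-B13's kernels, Lemma 2's
construction (1.33)–(1.43), the (2.19) profile per matrix element = (2.18) × (1.43) (landed: `B13Bound143.tau_mul_le_elem219`) + a lattice row sum,
and the cube-location of the row bonds — N09 ∕ NODE A; print-shaped data only: NO per-bond sum, NO shell counts are asked of the producer).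

HONEST FRAMING: records that are LISTS OF HYPOTHESES (inhabited only by supplying every located input; §3 shows they are not contradictory), their
faces and `Nonempty` shadow; the one proved inequality (`hm₃`) is (1.26) on the torus applied to HYPOTHESISED profile data; NO estimate of
Bałaban's asserted or constructed; SCOPE (inherited from W1-11; referee ref-H WATCH-239, 2026-08-27): the sup-ball `‖A‖ ≤ ρ` and the box-support
law are the OPTION-1 reading of [I] p. 266 (threshold `ε₁` on the UNSCALED field `B′`, boxes coupling-free in `A = s·B`); print's second option
(threshold `g_kε₁∕γ_k`, coupling-free in the SCALED variable) is NOT expressed by an s-free `χᵘ` — the inhabitant-of-record author states which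
threshold NODE 00's datum carries before instantiating; N22 ∕ N10 ∕ N09 ∕ NODE A NOT discharged; K3 untouched;
counts unmoved; one finite 𝕋⁴ programme at fixed ε, Bałaban as printed — NOT continuum ∕ ℝ⁴ ∕ infinite volume ∕ OS ∕ mass gap ∕ Clay.  No `sorry`,
no `axiom`, no `instance` declaration, no `notation`.

References (TYPES and page anchors only): [II] (1.26) p. 8, (1.34), (1.36) p. 9, Lemma 2 (1.41)–(1.43) p. 11, (2.2)–(2.3) p. 12, (2.14) p. 15,
(2.18)–(2.20) p. 16; [I] (2.8)–(2.9) p. 266, p. 267.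
-/

open scoped BigOperators

noncomputable section

namespace Literature.MathematicalPhysics.QuantumFieldTheory.Balaban1983to89.Node00

open Metric Set MeasureTheory
open Literature.MathematicalPhysics.QuantumFieldTheory.Balaban1983to89
open TreeLengthTorus Sect2
open Literature.MathematicalPhysics.QuantumFieldTheory.Balaban1983to89.B12TreeDecay (K₀ kappa₀ K₀_pos)

namespace W1

namespace TermDatum214

variable {c : B13.Consts} {P : Params} {𝔸 : Type*} {M k L : ℕ} [NeZero L] (𝔇 : TermDatum214 c P 𝔸 M k L)
variable (χu χcu : 𝔇.UnscaledChi) (𝒲 : 𝔇.UnscaledWilson) (𝒪 : 𝔇.UnscaledOlder)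

/-! ## §1  The local growth schema of the unscaled-field law's potentials at one term slice, as ONE record -/

/-- **THE LOCAL GROWTH INPUTS OF THE UNSCALED-FIELD LAW's POTENTIALS AT THE TERM SLICE `(Z, t, old, φ)`, FOR GIVEN PER-DOMAIN τ-REGIONS `Uτ`**
(Type-valued record; a LIST OF HYPOTHESES on the coupling-free `χᵘ, 𝒲, 𝒪` of W1-11's law — nothing asserted; COUPLING-FREE, hence uniform along
the real window).  Data: the cubic part `𝒲₃` of `𝒲(φ; Y, ·)`, the linear part `D𝒪` of `𝒪(old, φ; Y, ·)` at `0`, the sup-ball radius `ρ` ([II]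
(1.34): `|B| < ε₁g_k⁻¹`, i.e. `‖A‖ ≤ ε₁` in the unscaled field), the τ-radii bounds `R(Y)` of `Uτ Y`, the per-domain growth constants
`c₀ c₃ c₃′ c₄ c₁ c₁′ c₂` ((1.36): decay in `d_k(Y)` makes them domain-dependent), the bond supports `S Y`, the cube-location `cubeOf` of the row
bonds and the (2.19) profile constants `C_p, κ_p` of the rate weight `R(Y)c₃(Y)` (p. 16: the (2.20) forms «resummed over all Y∈𝐃_k containing … the
point b₋ … We use the first exponential factor in (2.19) to bound the sum, and this yields a constant O(1)»), the box-support coordinate set `S₀`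
((2.2)–(2.3), [I] (2.9)).  Propositions, in the binder order of `B13Bound226CentredUnscaled.h226_torus_windowDilated_centred_of_localGrowth_perBond`
§4∕§5 at `D := 𝐃om`, `Dfam := 𝐃 = t.1`, `Λ := (𝒦 Z t).Λ`, `𝒲 := 𝒲(φ;·,·)`, `𝒪 := 𝒪(old,φ;·,·)`, `χ_{Y₀} := χᵘ`: measurability, homogeneity of
`𝒲₃ ∕ D𝒪`, nonnegativity on `𝐃`, `‖z‖ ≤ R(Y)` on `Uτ Y`, the LOCAL letters (L0)–(L6) and (ℓ1) on `‖A‖ ≤ ρ`, (G) `b ∈ S Y → cubeOf b ∈ Y`, (P)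
`R(Y)c₃(Y) ≤ C_p e^{−κ_p d_k(Y)}` with `κ_p ≥ κ₀(4·2^d, 2d)`, the s-FREE box-support law `χᵘ(A) ≠ 0 → |A_b| ≤ ρ (b ∈ S₀)` and the `Y`-locality of
the potentials in `S₀`; the per-bond multiplicity (`m₃`, `hm₃0`, `hm₃`) is a DERIVED face ((1.26) on the torus).  NOT fields (consumer's side): the
base point `s > 0`, the rate `δ` and the two numeric closure inequalities with the capstone's `a_c, w_c`.
[cite: Balaban1988RG2Cluster, (1.34) and (1.36) p.9, Lemma 2 (1.41)-(1.43) p.11, (2.2)-(2.3) p.12, (2.14) p.15, (2.18)-(2.20) p.16, (1.26) p.8; Balaban1987RG1, (2.8)-(2.9) p.266 and p.267] -/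
structure LocalGrowthInputs (Z : (domSys P M (k + 1)).Dom) (t : TermLabel P M k L) (old : OlderTerms P 𝔸 M k) (φ : CPair P 𝔸)
    (Uτ : TDom P.d (L * domCount P M (k + 1)) → Set ℂ) where
  -- Lemma 2's leading parts: the CUBIC part of the Wilson remainder and the LINEAR part of the older terms at the zero field (located inputs)
  𝒲₃ : TDom P.d (L * domCount P M (k + 1)) → ((𝔇.𝒦 Z t).Λ → ℝ) → ℂ
  D𝒪 : TDom P.d (L * domCount P M (k + 1)) → ((𝔇.𝒦 Z t).Λ → ℝ) → ℂ
  -- the radius of the sup-ball of the unscaled field (print's ε₁; coupling-free)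
  ρ : ℝ
  hρ : 0 < ρ
  -- measurability in the unscaled row-bond field
  h𝒲m : ∀ Y, Measurable (𝒲 Z t φ Y)
  h𝒪m : ∀ Y, Measurable (𝒪 Z t old φ Y)
  h𝒲₃m : ∀ Y, Measurable (𝒲₃ Y)
  hD𝒪m : ∀ Y, Measurable (D𝒪 Y)
  -- homogeneity of the leading parts under real dilations
  h𝒲₃ : ∀ Y (r : ℝ) (A : (𝔇.𝒦 Z t).Λ → ℝ), 𝒲₃ Y (r • A) = (r : ℂ) ^ 3 * 𝒲₃ Y A
  hD𝒪 : ∀ Y (r : ℝ) (A : (𝔇.𝒦 Z t).Λ → ℝ), D𝒪 Y (r • A) = (r : ℂ) * D𝒪 Y A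
  -- the τ-radii bounds of the per-domain regions and the per-domain growth constants
  R : TDom P.d (L * domCount P M (k + 1)) → ℝ
  c₀ : TDom P.d (L * domCount P M (k + 1)) → ℝ
  c₃ : TDom P.d (L * domCount P M (k + 1)) → ℝ
  c₃' : TDom P.d (L * domCount P M (k + 1)) → ℝ
  c₄ : TDom P.d (L * domCount P M (k + 1)) → ℝ
  c₁ : TDom P.d (L * domCount P M (k + 1)) → ℝ
  c₁' : TDom P.d (L * domCount P M (k + 1)) → ℝ
  c₂ : TDom P.d (L * domCount P M (k + 1)) → ℝ
  hR : ∀ Y ∈ t.1, 0 ≤ R Y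
  hc₃ : ∀ Y ∈ t.1, 0 ≤ c₃ Y
  hc₃' : ∀ Y ∈ t.1, 0 ≤ c₃' Y
  hc₄ : ∀ Y ∈ t.1, 0 ≤ c₄ Y
  hc₁ : ∀ Y ∈ t.1, 0 ≤ c₁ Y
  hc₁' : ∀ Y ∈ t.1, 0 ≤ c₁' Y
  hc₂ : ∀ Y ∈ t.1, 0 ≤ c₂ Y
  hUτR : ∀ Y ∈ t.1, ∀ z ∈ Uτ Y, ‖z‖ ≤ R Y
  -- the LOCAL growth letters (L0), (L1) on the sup-ball `‖A‖ ≤ ρ`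
  h0 : ∀ Y ∈ t.1, ‖𝒪 Z t old φ Y 0‖ ≤ c₀ Y
  h1 : ∀ Y ∈ t.1, ∀ A : (𝔇.𝒦 Z t).Λ → ℝ, ‖A‖ ≤ ρ → ‖𝒲 Z t φ Y A‖ ≤ c₃ Y * ‖A‖ ^ 3
  -- the bond supports `S Y` (ONE map) and the Y-LOCALISED cubic letter (ℓ1)
  S : TDom P.d (L * domCount P M (k + 1)) → Finset (𝔇.𝒦 Z t).Λ
  h1loc : ∀ Y ∈ t.1, ∀ A : (𝔇.𝒦 Z t).Λ → ℝ, ‖A‖ ≤ ρ → ‖𝒲 Z t φ Y A‖ ≤ c₃ Y * ‖A‖ * ∑ b ∈ S Y, A b ^ 2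
  -- (G) the CUBE-LOCATION of the row bonds, the supports `S Y` lying in `Y`; (P) the (2.19) PROFILE of the rate weight `R(Y)c₃(Y)`:
  -- tree-length decay at a rate above the (1.26) threshold `κ₀(4·2^d, 2d)` — the per-bond multiplicity `m₃ = C_p·K₀(4·2^d, 2d)` then
  -- FOLLOWS by (1.26) on the torus (faces `m₃`, `hm₃0`, `hm₃` below; NOT a field)
  cubeOf : (𝔇.𝒦 Z t).Λ → TPt P.d (L * domCount P M (k + 1))
  hS : ∀ Y ∈ t.1, ∀ b ∈ S Y, cubeOf b ∈ Y.1
  Cp : ℝ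
  κp : ℝ
  hCp : 0 ≤ Cp
  hκp : kappa₀ (4 * 2 ^ P.d) (2 * P.d) ≤ κp
  hdecay : ∀ Y ∈ t.1, R Y * c₃ Y ≤ Cp * Real.exp (-κp * (tsys P.d (L * domCount P M (k + 1))).dj Y)
  -- the LOCAL letters (L2), (L4), (L5) on the sup-ball and the global (L3), (L6) of the homogeneous parts
  h2 : ∀ Y ∈ t.1, ∀ A : (𝔇.𝒦 Z t).Λ → ℝ, ‖A‖ ≤ ρ → ‖𝒲 Z t φ Y A - 𝒲₃ Y A‖ ≤ c₄ Y * ‖A‖ ^ 4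
  h3 : ∀ Y ∈ t.1, ∀ A : (𝔇.𝒦 Z t).Λ → ℝ, ‖𝒲₃ Y A‖ ≤ c₃' Y * ‖A‖ ^ 3
  h4 : ∀ Y ∈ t.1, ∀ A : (𝔇.𝒦 Z t).Λ → ℝ, ‖A‖ ≤ ρ → ‖𝒪 Z t old φ Y A - 𝒪 Z t old φ Y 0‖ ≤ c₁ Y * ‖A‖
  h5 : ∀ Y ∈ t.1, ∀ A : (𝔇.𝒦 Z t).Λ → ℝ, ‖A‖ ≤ ρ →
      ‖𝒪 Z t old φ Y A - 𝒪 Z t old φ Y 0 - D𝒪 Y A‖ ≤ c₂ Y * ‖A‖ ^ 2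
  h6 : ∀ Y ∈ t.1, ∀ A : (𝔇.𝒦 Z t).Λ → ℝ, ‖D𝒪 Y A‖ ≤ c₁' Y * ‖A‖
  -- the BOX-SUPPORT LAW of `χᵘ` on the UNSCALED field (s-free) and the Y-LOCALITY of the potentials in `S₀`
  S₀ : Set (𝔇.𝒦 Z t).Λ
  hbox : ∀ A : (𝔇.𝒦 Z t).Λ → ℝ, χu Z t A ≠ 0 → ∀ b ∈ S₀, |A b| ≤ ρ
  hloc𝒲 : ∀ Y ∈ t.1, ∀ A A' : (𝔇.𝒦 Z t).Λ → ℝ, (∀ b ∈ S₀, A b = A' b) → 𝒲 Z t φ Y A = 𝒲 Z t φ Y A'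
  hloc𝒪 : ∀ Y ∈ t.1, ∀ A A' : (𝔇.𝒦 Z t).Λ → ℝ, (∀ b ∈ S₀, A b = A' b) → 𝒪 Z t old φ Y A = 𝒪 Z t old φ Y A'

/-- **Propositional shadow**: the local growth letters HOLD at the slice (some record of inputs exists) — the form a schema line quantifies
(«`∀ Z t old φ, 𝔇.LocalGrowthLetters χᵘ 𝒲 𝒪 Z t old φ Uτ`»). [cite: Balaban1988RG2Cluster, Lemma 2 (1.41)-(1.43) p.11 and (1.36) p.9] -/
def LocalGrowthLetters (Z : (domSys P M (k + 1)).Dom) (t : TermLabel P M k L) (old : OlderTerms P 𝔸 M k) (φ : CPair P 𝔸)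
    (Uτ : TDom P.d (L * domCount P M (k + 1)) → Set ℂ) : Prop :=
  Nonempty (𝔇.LocalGrowthInputs χu 𝒲 𝒪 Z t old φ Uτ)

namespace LocalGrowthInputs

variable {𝔇 χu 𝒲 𝒪}
variable {Z : (domSys P M (k + 1)).Dom} {t : TermLabel P M k L} {old : OlderTerms P 𝔸 M k} {φ : CPair P 𝔸}
  {Uτ : TDom P.d (L * domCount P M (k + 1)) → Set ℂ}

/-- The shadow holds as soon as a record is given. [cite: Balaban1988RG2Cluster, Lemma 2 p.11 (bookkeeping)] -/
theorem letters (I : 𝔇.LocalGrowthInputs χu 𝒲 𝒪 Z t old φ Uτ) : 𝔇.LocalGrowthLetters χu 𝒲 𝒪 Z t old φ Uτ := ⟨I⟩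

/-- **The box-support law AT A REAL BASE POINT `s₀`** — the `hbox` binder of dag-n10-c's §4∕§5 for the law's box `χ_{Y₀}(s₀, B) = χᵘ(s₀·B)`:
`χᵘ(s₀·B) ≠ 0 → ∀ b ∈ S₀, |(s₀·B)_b| ≤ ρ` (the s-free law read at `A := s₀·B`; definitional).
[cite: Balaban1987RG1, (2.9) p.266 and p.267 («B = g_kB′»); Balaban1988RG2Cluster, (2.3) p.12] -/
theorem hbox_smul (I : 𝔇.LocalGrowthInputs χu 𝒲 𝒪 Z t old φ Uτ) (s₀ : ℝ) :
    ∀ B : (𝔇.𝒦 Z t).Λ → ℝ, χu Z t (s₀ • B) ≠ 0 → ∀ b ∈ I.S₀, |(s₀ • B) b| ≤ I.ρ :=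
  fun B hB => I.hbox (s₀ • B) hB

/-- **The per-bond multiplicity constant `m₃ := C_p·K₀(4·2^d, 2d)`** of the rate weight `R(Y)c₃(Y)` — the constant «O(1)» of [II] p. 16
(*"We use the first exponential factor in (2.19) to bound the sum, and this yields a constant O(1)"*), read off the (2.19) profile by (1.26).
[cite: Balaban1988RG2Cluster, (2.19)-(2.20) p.16 and (1.26) p.8] -/
def m₃ (I : 𝔇.LocalGrowthInputs χu 𝒲 𝒪 Z t old φ Uτ) : ℝ :=
  I.Cp * K₀ (4 * 2 ^ P.d) (2 * P.d)

/-- `m₃ = C_p·K₀(4·2^d, 2d)`. [cite: Balaban1988RG2Cluster, (2.20) p.16 (bookkeeping)] -/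
theorem m₃_eq (I : 𝔇.LocalGrowthInputs χu 𝒲 𝒪 Z t old φ Uτ) : I.m₃ = I.Cp * K₀ (4 * 2 ^ P.d) (2 * P.d) := rfl

/-- `0 ≤ m₃` (the `hm₃0` binder of dag-n10-c's §4∕§5). [cite: Balaban1988RG2Cluster, (2.20) p.16 (bookkeeping)] -/
theorem hm₃0 (I : 𝔇.LocalGrowthInputs χu 𝒲 𝒪 Z t old φ Uτ) : 0 ≤ I.m₃ :=
  mul_nonneg I.hCp (K₀_pos _ _).le

/-- **THE PER-BOND MULTIPLICITY OF THE RATE WEIGHT, DERIVED** (the `hm₃` binder of dag-n10-c's §4∕§5; [II] p. 16: the (2.20) forms *"resummed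
over all Y∈𝐃_k containing, for example, the point b₋ … a constant O(1)"*): for every row bond `b`,
`Σ_{Y ∈ 𝐃, b ∈ S Y} R(Y)c₃(Y) ≤ Σ_{Y ∋ cubeOf b} C_p e^{−κ_p d_k(Y)} ≤ C_p·K₀(4·2^d, 2d) = m₃` — cube-location (G), the profile (P) and (1.26) ON THE
TORUS (`TreeLengthTorus.ineq126_torus`, a tree theorem with no hypothesis on the geometry).  One (1.26) step; no estimate of Bałaban's asserted.
[cite: Balaban1988RG2Cluster, (2.19)-(2.20) p.16 and (1.26) p.8] -/
theorem hm₃ (I : 𝔇.LocalGrowthInputs χu 𝒲 𝒪 Z t old φ Uτ) :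
    ∀ bd : (𝔇.𝒦 Z t).Λ, ∑ Y ∈ t.1 with bd ∈ I.S Y, I.R Y * I.c₃ Y ≤ I.m₃ := by
  intro bd
  have h126 := ineq126_torus P.d (L * domCount P M (k + 1)) I.hκp (I.cubeOf bd)
  calc ∑ Y ∈ t.1 with bd ∈ I.S Y, I.R Y * I.c₃ Y
      ≤ ∑ Y ∈ t.1 with bd ∈ I.S Y, I.Cp * Real.exp (-I.κp * (tsys P.d (L * domCount P M (k + 1))).dj Y) :=
        Finset.sum_le_sum fun Y hY => I.hdecay Y (Finset.mem_filter.1 hY).1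
    _ ≤ ∑ Y ∈ (tcubeSys P.d (L * domCount P M (k + 1))).above (I.cubeOf bd),
          I.Cp * Real.exp (-I.κp * (tsys P.d (L * domCount P M (k + 1))).dj Y) := by
        refine Finset.sum_le_sum_of_subset_of_nonneg (fun Y hY => ?_) fun Y _ _ => mul_nonneg I.hCp (Real.exp_nonneg _)
        have hY' := Finset.mem_filter.1 hY
        exact (B12TreeDecay.CubeSystem.mem_above (G := tcubeSys P.d (L * domCount P M (k + 1))) (c := I.cubeOf bd)
          (X := Y)).2 (I.hS Y hY'.1 bd hY'.2)
    _ = I.Cp * ∑ Y ∈ (tcubeSys P.d (L * domCount P M (k + 1))).above (I.cubeOf bd),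
          Real.exp (-I.κp * (tsys P.d (L * domCount P M (k + 1))).dj Y) := by rw [Finset.mul_sum]
    _ ≤ I.Cp * K₀ (4 * 2 ^ P.d) (2 * P.d) := mul_le_mul_of_nonneg_left h126 I.hCp
    _ = I.m₃ := rfl

/-- **Antitone in the τ-regions**: inputs for regions `Uτ` are inputs for any smaller regions `Uτ' Y ⊆ Uτ Y` (`Y ∈ 𝐃`), all other fields kept.
[cite: Balaban1988RG2Cluster, (2.18) p.16 (bookkeeping)] -/
def restrict (I : 𝔇.LocalGrowthInputs χu 𝒲 𝒪 Z t old φ Uτ) {Uτ' : TDom P.d (L * domCount P M (k + 1)) → Set ℂ}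
    (hU : ∀ Y ∈ t.1, Uτ' Y ⊆ Uτ Y) : 𝔇.LocalGrowthInputs χu 𝒲 𝒪 Z t old φ Uτ' :=
  { I with hUτR := fun Y hY z hz => I.hUτR Y hY z (hU Y hY hz) }

/-- `restrict` keeps the radius. [cite: Balaban1988RG2Cluster, (2.18) p.16 (bookkeeping)] -/
@[simp] theorem restrict_ρ (I : 𝔇.LocalGrowthInputs χu 𝒲 𝒪 Z t old φ Uτ) {Uτ' : TDom P.d (L * domCount P M (k + 1)) → Set ℂ}
    (hU : ∀ Y ∈ t.1, Uτ' Y ⊆ Uτ Y) : (I.restrict hU).ρ = I.ρ := rfl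

/-- `restrict` keeps the bond supports. [cite: Balaban1988RG2Cluster, (2.18) p.16 (bookkeeping)] -/
@[simp] theorem restrict_S (I : 𝔇.LocalGrowthInputs χu 𝒲 𝒪 Z t old φ Uτ) {Uτ' : TDom P.d (L * domCount P M (k + 1)) → Set ℂ}
    (hU : ∀ Y ∈ t.1, Uτ' Y ⊆ Uτ Y) : (I.restrict hU).S = I.S := rfl

/-- `restrict` keeps the per-bond multiplicity constant. [cite: Balaban1988RG2Cluster, (2.18) p.16 (bookkeeping)] -/
@[simp] theorem restrict_m₃ (I : 𝔇.LocalGrowthInputs χu 𝒲 𝒪 Z t old φ Uτ) {Uτ' : TDom P.d (L * domCount P M (k + 1)) → Set ℂ}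
    (hU : ∀ Y ∈ t.1, Uτ' Y ⊆ Uτ Y) : (I.restrict hU).m₃ = I.m₃ := rfl

/-- The shadow is antitone in the τ-regions. [cite: Balaban1988RG2Cluster, (2.18) p.16 (bookkeeping)] -/
theorem _root_.Literature.MathematicalPhysics.QuantumFieldTheory.Balaban1983to89.Node00.W1.TermDatum214.LocalGrowthLetters.restrict
    (h : 𝔇.LocalGrowthLetters χu 𝒲 𝒪 Z t old φ Uτ) {Uτ' : TDom P.d (L * domCount P M (k + 1)) → Set ℂ}
    (hU : ∀ Y ∈ t.1, Uτ' Y ⊆ Uτ Y) : 𝔇.LocalGrowthLetters χu 𝒲 𝒪 Z t old φ Uτ' :=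
  h.elim fun I => ⟨I.restrict hU⟩

end LocalGrowthInputs

/-! ## §2  The laws of the unscaled boxes: nonnegative, even, measurable -/

/-- **THE LAWS OF THE UNSCALED BOXES AT THE TERM `(Z, t)`** (hypothesis schema on the coupling-free `χᵘ, χᶜᵘ` of W1-11's law; nothing asserted):
print's boxes are products of characteristic functions of SYMMETRIC coordinate intervals of the unscaled field ([I] (2.9) `Π χ({|B′(b)| < ε₁})`,
[II] (2.3) `χ_{k,Y₀}`, `χᶜ_{k,P}`), hence NONNEGATIVE, EVEN under `A ↦ −A` and MEASURABLE — the parity that kills the first-order part of the centred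
mean (Summit-side binders `hχ0 hχc0 hχe hχce hχm hχcm`, displayed there at `s₀·B`).
[cite: Balaban1987RG1, (2.9) p.266; Balaban1988RG2Cluster, (2.3) p.12 and (2.14) p.15] -/
structure UnscaledBoxLaws (Z : (domSys P M (k + 1)).Dom) (t : TermLabel P M k L) : Prop where
  hχ0 : ∀ A : (𝔇.𝒦 Z t).Λ → ℝ, 0 ≤ χu Z t A
  hχc0 : ∀ A : (𝔇.𝒦 Z t).Λ → ℝ, 0 ≤ χcu Z t A
  hχe : ∀ A : (𝔇.𝒦 Z t).Λ → ℝ, χu Z t (-A) = χu Z t A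
  hχce : ∀ A : (𝔇.𝒦 Z t).Λ → ℝ, χcu Z t (-A) = χcu Z t A
  hχm : Measurable (χu Z t)
  hχcm : Measurable (χcu Z t)

namespace UnscaledBoxLaws

variable {𝔇 χu χcu}
variable {Z : (domSys P M (k + 1)).Dom} {t : TermLabel P M k L}

/-- The boxes AT A BASE POINT are nonnegative (`hχ0 ∕ hχc0` shapes). [cite: Balaban1987RG1, (2.9) p.266; Balaban1988RG2Cluster, (2.3) p.12] -/
theorem nonneg_smul (h : 𝔇.UnscaledBoxLaws χu χcu Z t) (s₀ : ℝ) :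
    (∀ B : (𝔇.𝒦 Z t).Λ → ℝ, 0 ≤ χu Z t (s₀ • B)) ∧ ∀ B : (𝔇.𝒦 Z t).Λ → ℝ, 0 ≤ χcu Z t (s₀ • B) :=
  ⟨fun _ => h.hχ0 _, fun _ => h.hχc0 _⟩

/-- The boxes AT A BASE POINT are even in the integration field (`hχe ∕ hχce` shapes: `χᵘ(s₀·(−B)) = χᵘ(s₀·B)`).
[cite: Balaban1987RG1, (2.9) p.266; Balaban1988RG2Cluster, (2.3) p.12] -/
theorem even_smul (h : 𝔇.UnscaledBoxLaws χu χcu Z t) (s₀ : ℝ) :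
    (∀ B : (𝔇.𝒦 Z t).Λ → ℝ, χu Z t (s₀ • (-B)) = χu Z t (s₀ • B)) ∧
      ∀ B : (𝔇.𝒦 Z t).Λ → ℝ, χcu Z t (s₀ • (-B)) = χcu Z t (s₀ • B) :=
  ⟨fun B => by rw [smul_neg, h.hχe], fun B => by rw [smul_neg, h.hχce]⟩

/-- The boxes AT A BASE POINT are measurable in the integration field (`hχm ∕ hχcm` shapes; the scaling `B ↦ s₀ • B` is measurable by
Mathlib's `measurable_const_smul`). [cite: Balaban1987RG1, (2.9) p.266; Balaban1988RG2Cluster, (2.3) p.12] -/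
theorem measurable_smul (h : 𝔇.UnscaledBoxLaws χu χcu Z t) (s₀ : ℝ) :
    (Measurable fun B : (𝔇.𝒦 Z t).Λ → ℝ => χu Z t (s₀ • B)) ∧ Measurable fun B : (𝔇.𝒦 Z t).Λ → ℝ => χcu Z t (s₀ • B) :=
  ⟨h.hχm.comp (measurable_const_smul s₀), h.hχcm.comp (measurable_const_smul s₀)⟩

end UnscaledBoxLaws

/-! ## §3  Honesty: the schemas are consistent (inhabited by the zero potentials ∕ the constant boxes) -/

/-- **The zero potentials with empty supports inhabit the local growth schema** as soon as the τ-regions are bounded on `𝐃` (every constant `0`,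
`ρ = 1`, `S Y = ∅`, `S₀ = ∅`, zero profile at the threshold rate `κ₀(4·2^d, 2d)`, all bonds located at the cube `0`; the bound `R(Y)` is the given
one).  Consistency witness only — NOT Bałaban's potentials.
[cite: Balaban1988RG2Cluster, Lemma 2 p.11 (bookkeeping)] -/
def localGrowthInputsZero (Z : (domSys P M (k + 1)).Dom) (t : TermLabel P M k L) (old : OlderTerms P 𝔸 M k) (φ : CPair P 𝔸)
    (Uτ : TDom P.d (L * domCount P M (k + 1)) → Set ℂ) (Rb : TDom P.d (L * domCount P M (k + 1)) → ℝ) (hRb : ∀ Y ∈ t.1, 0 ≤ Rb Y)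
    (hU : ∀ Y ∈ t.1, ∀ z ∈ Uτ Y, ‖z‖ ≤ Rb Y) :
    𝔇.LocalGrowthInputs χu (fun _ _ _ _ _ => 0) (fun _ _ _ _ _ _ => 0) Z t old φ Uτ where
  𝒲₃ := fun _ _ => 0
  D𝒪 := fun _ _ => 0
  ρ := 1
  hρ := one_pos
  h𝒲m := fun _ => measurable_const
  h𝒪m := fun _ => measurable_const
  h𝒲₃m := fun _ => measurable_const
  hD𝒪m := fun _ => measurable_const
  h𝒲₃ := fun _ _ _ => by simp
  hD𝒪 := fun _ _ _ => by simp
  R := Rb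
  c₀ := fun _ => 0
  c₃ := fun _ => 0
  c₃' := fun _ => 0
  c₄ := fun _ => 0
  c₁ := fun _ => 0
  c₁' := fun _ => 0
  c₂ := fun _ => 0
  hR := hRb
  hc₃ := fun _ _ => le_rfl
  hc₃' := fun _ _ => le_rfl
  hc₄ := fun _ _ => le_rfl
  hc₁ := fun _ _ => le_rfl
  hc₁' := fun _ _ => le_rfl
  hc₂ := fun _ _ => le_rfl
  hUτR := hU
  h0 := fun _ _ => by simp
  h1 := fun _ _ _ _ => by simp
  S := fun _ => ∅
  h1loc := fun _ _ _ _ => by simp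
  cubeOf := fun _ => 0
  hS := fun _ _ _ hb => (Finset.notMem_empty _ hb).elim
  Cp := 0
  κp := kappa₀ (4 * 2 ^ P.d) (2 * P.d)
  hCp := le_rfl
  hκp := le_rfl
  hdecay := fun _ _ => by simp
  h2 := fun _ _ _ _ => by simp
  h3 := fun _ _ _ => by simp
  h4 := fun _ _ _ _ => by simp
  h5 := fun _ _ _ _ => by simp
  h6 := fun _ _ _ => by simp
  S₀ := ∅
  hbox := fun _ _ _ hb => (Set.notMem_empty _ hb).elim
  hloc𝒲 := fun _ _ _ _ _ => rfl
  hloc𝒪 := fun _ _ _ _ _ => rfl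

/-- The shadow for the zero potentials, under bounded τ-regions on `𝐃`. [cite: Balaban1988RG2Cluster, Lemma 2 p.11 (bookkeeping)] -/
theorem localGrowthLetters_zero (Z : (domSys P M (k + 1)).Dom) (t : TermLabel P M k L) (old : OlderTerms P 𝔸 M k) (φ : CPair P 𝔸)
    {Uτ : TDom P.d (L * domCount P M (k + 1)) → Set ℂ} (hU : ∀ Y ∈ t.1, ∃ Rb : ℝ, 0 ≤ Rb ∧ ∀ z ∈ Uτ Y, ‖z‖ ≤ Rb) :
    𝔇.LocalGrowthLetters χu (fun _ _ _ _ _ => 0) (fun _ _ _ _ _ _ => 0) Z t old φ Uτ := by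
  classical
  refine ⟨𝔇.localGrowthInputsZero χu Z t old φ Uτ (fun Y => if h : Y ∈ t.1 then (hU Y h).choose else 0) ?_ ?_⟩
  · intro Y hY; simp only [dif_pos hY]; exact (hU Y hY).choose_spec.1
  · intro Y hY z hz; simp only [dif_pos hY]; exact (hU Y hY).choose_spec.2 z hz

/-- **The constant boxes `χᵘ ≡ χᶜᵘ ≡ 1` obey the box laws** (consistency witness only). [cite: Balaban1987RG1, (2.9) p.266 (bookkeeping)] -/
theorem unscaledBoxLaws_const (Z : (domSys P M (k + 1)).Dom) (t : TermLabel P M k L) :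
    𝔇.UnscaledBoxLaws (fun _ _ _ => 1) (fun _ _ _ => 1) Z t where
  hχ0 := fun _ => zero_le_one
  hχc0 := fun _ => zero_le_one
  hχe := fun _ => rfl
  hχce := fun _ => rfl
  hχm := measurable_const
  hχcm := measurable_const

end TermDatum214

end W1

end Literature.MathematicalPhysics.QuantumFieldTheory.Balaban1983to89.Node00

end
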